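import Summits.BirchSwinnertonDyer.BirchSwinnertonDyer.Theorems.PrintX11aUpperNonSurjFiveExcCore
import Summits.BirchSwinnertonDyer.BirchSwinnertonDyer.Theorems.PrintX11aUpperNonSurjFiveExcPeriodCycle
import Literature.NumberTheory.EllipticCurves.ModularCurveRealPeriodProofs
import HarnessLib

/-!
# Crux U5 `PrintX11a.UpperNonSurjFive` (item stmt-BirchSwinnertonDyer-20614), line «gl1cartan5», EXCEPTIONAL-ZERO road:
# the CORE without an integrality hypothesis on `[x]⁺_f` — the comparison `Ω_f^{can}/Ω⁺_f` is read on a CYCLE, where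
# `[γ∞]⁺_f ∈ ½ℤ` is automatic — and its Greenberg–Vatsal wrapper (general odd `p`, `p ∥ N`)

Cell `bsd-print-x11a`, seat `cruxlead-stmt-BirchSwinnertonDyer-20614` (LEAD g6); `--supports stmt-BirchSwinnertonDyer-20614`,
closes nothing. File 2b of the EXCEPTIONAL-ZERO road. `…ExcCore.one_le_padicValRat_ratPlusSymbol_zero_of_symbolCongruence` (like the
acc2 THEOREM A at `p = 3`) carries the binder «`[x]⁺_f` is `p`-integral for EVERY `x ∈ ℚ`» (Kim's standing hypothesis; the tree proves
it only for `gcd(den x, N) = 1`, `IsNewformOf.norm_ratPlusSymbol_le_one`), used once: to see that `κ = Ω_f/Ω⁺_f` (Vatsal's canonical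
period over the lattice period) is integral, by evaluating at the point `x₁` where `plusSymbol f/Ω_f` is a unit. THIS FILE removes the
binder: by `…ExcPeriodCycle` the unit point may be taken ON A CYCLE `{∞, γ₁∞}`, `γ₁ ∈ Γ₀(N)`, and there
`plusSymbol f (γ₁∞) = re{∞, γ₁∞}_f ∈ re Λ_f = ℤ·(Ω⁺_f/2)` by the very definition of `Ω⁺_f = plusPeriod f`
(`realPeriods_eq_zmultiples_of_plusPeriod_pos`), i.e. `[γ₁∞]⁺_f ∈ ½ℤ ⊂ ℤ_(p)` (`p` odd). Theorems only; no definition, no named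
fact, no `sorry`; nothing about any curve is asserted; BSD is not proved by any of this.

* §1 `exists_int_plusSymbol_cusp_eq` (`plusSymbol f (γ∞) = (m/2)·Ω⁺_f`), `norm_ratPlusSymbol_cusp_le_one` (`p` odd).
* §2 ★ `one_le_padicValRat_ratPlusSymbol_zero_of_symbolCongruence_cycle` — THE CORE, cycle version: Vatsal's conclusion shape for
  `(f, g')` with the `f`-unit ON A CYCLE + old shape `plusSymbol g' = Φ − cΦ(q·)`, `c ≡ 1` + non-degeneracy `Ω` ⟹ `[0]⁺_f = 0` or
  `1 ≤ ord_p [0]⁺_f`.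
* §3 `one_le_padicValRat_ratPlusSymbol_zero_of_greenbergVatsal_cycle` — the same from `greenbergVatsal2000_plusSymbol_congruence` BY NAME,
  the path-unit of the fact moved to a cycle with ONE prime `r₀ ≡ 1 (mod N)`, `a_{r₀}(f) − r₀ − 1` a unit (the Chebotarev numeral of the
  assembly), and the non-degeneracy PRODUCED from `plusSymbol g' ≢ 0`.

## References

* V. Vatsal, Duke Math. J. 98 (1999), §1 (1.3) display (5), (1.6) display (11), Remark (1.12), Thm. (1.13) [Vatsal1999]; R. Greenberg,
  V. Vatsal, Invent. Math. 142 (2000), §3 (17)–(19), Prop. (3.1), Remark (3.4), Lemma (3.6) [GreenbergVatsal2000]; B. Mazur, J. Tate,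
  J. Teitelbaum, Invent. Math. 84 (1986), §I.8 [MazurTateTeitelbaum1986Invent]; J. E. Cremona (1997), §2.8 [CremonaAlgorithms1997].
-/

set_option autoImplicit false
-- the Theorems namespace of a single-conjunct summit repeats the summit name by design (D-0017)
set_option linter.dupNamespace false

noncomputable section

open scoped MatrixGroups ModularForm Classical NNReal

open CongruenceSubgroup WeierstrassCurve Literature.NumberTheory.EllipticCurves
  Literature.NumberTheory.EllipticCurves.ModularForms

namespace Summit.BirchSwinnertonDyer.BirchSwinnertonDyer.Theorems.GL1Cartan.Exc

open Literature.NumberTheory.EllipticCurves.ModularForms.DeligneSerreLift (norm_intCast_le_one norm_intCast_eq_one_of_not_dvd)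
open Summit.BirchSwinnertonDyer.BirchSwinnertonDyer.Theorems.KimAtThreeDeepLowerOffStratumLevelLoweringVatsal
  (plusSymbol_eq_ratPlusSymbol_mul_plusPeriod)
open Summit.BirchSwinnertonDyer.BirchSwinnertonDyer.Theorems.KimAtThreeDeepLowerOffStratumLevelLoweringVatsalRows
  (finiteDimensional_coeffField_of_isNewformOf)

/-! ### §1 On a cycle the lattice-normalised plus symbol lies in `½ℤ` -/

section Cusp

variable {p : ℕ} [Fact p.Prime] {W : WeierstrassCurve ℚ} {N : ℕ} [NeZero N] {f : CuspForm (Gamma0 N) 2}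

omit [Fact p.Prime] in
/-- **`plusSymbol f (γ∞) = (m/2)·Ω⁺_f` with `m ∈ ℤ`** for the newform `f` of an elliptic curve and `γ ∈ Γ₀(N)` with `γ∞ ≠ ∞`:
`plusSymbol f (a/c) = re{∞, a/c}_f` (real coefficients), `{∞, γ∞}_f ∈ Λ_f`, and `re Λ_f = ℤ·(Ω⁺_f/2)` by the definition of
`Ω⁺_f = plusPeriod f > 0`. [cite: CremonaAlgorithms1997, §2.8] [cite: MazurTateTeitelbaum1986Invent, §I.8] -/
theorem exists_int_plusSymbol_cusp_eq (hf : IsNewformOf W f) (γ : Gamma0 N) (hγ : (γ : SL(2, ℤ)) 1 0 ≠ 0) :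
    ∃ m : ℤ, plusSymbol f ((((γ : SL(2, ℤ)) 0 0 : ℤ) : ℚ) / (((γ : SL(2, ℤ)) 1 0 : ℤ) : ℚ)) =
      ((m : ℂ) / 2) * ((plusPeriod f : ℝ) : ℂ) := by
  have hreal : ∀ n, (cuspCoeff f n).im = 0 := fun n => by rw [hf.2 n]; simp
  have hΩ : 0 < plusPeriod f := IsNewform0.plusPeriod_pos_holds hf.1 hf.coeffField_eq_bot
  have hre : realPeriods f = AddSubgroup.zmultiples (plusPeriod f / 2) := realPeriods_eq_zmultiples_of_plusPeriod_pos f hΩ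
  set x : ℚ := (((γ : SL(2, ℤ)) 0 0 : ℤ) : ℚ) / (((γ : SL(2, ℤ)) 1 0 : ℤ) : ℚ) with hx
  have hcusp : cuspSymbol f γ = modularSymbol f x := by
    rw [cuspSymbol, if_neg hγ]
  have hmem : (modularSymbol f x).re ∈ realPeriods f := by
    rw [← hcusp]
    exact AddSubgroup.mem_map_of_mem _ (cuspSymbol_mem_periodLattice f γ)
  rw [hre, AddSubgroup.mem_zmultiples_iff] at hmem
  obtain ⟨m, hm⟩ := hmem
  refine ⟨m, ?_⟩
  rw [plusSymbol_eq_re_holds f hreal x, ← hm]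
  push_cast
  ring

/-- **`[γ∞]⁺_f` is `p`-integral for `p` odd**: `[γ∞]⁺_f = m/2`. [cite: MazurTateTeitelbaum1986Invent, §I.8] -/
theorem norm_ratPlusSymbol_cusp_le_one (hf : IsNewformOf W f) (hp2 : p ≠ 2) (γ : Gamma0 N) (hγ : (γ : SL(2, ℤ)) 1 0 ≠ 0) :
    ‖((ratPlusSymbol f ((((γ : SL(2, ℤ)) 0 0 : ℤ) : ℚ) / (((γ : SL(2, ℤ)) 1 0 : ℤ) : ℚ)) : ℚ) : ℚ_[p])‖ ≤ 1 := by
  have hp : p.Prime := Fact.out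
  have hΩ : 0 < plusPeriod f := IsNewform0.plusPeriod_pos_holds hf.1 hf.coeffField_eq_bot
  set x : ℚ := (((γ : SL(2, ℤ)) 0 0 : ℤ) : ℚ) / (((γ : SL(2, ℤ)) 1 0 : ℤ) : ℚ) with hx
  obtain ⟨m, hm⟩ := exists_int_plusSymbol_cusp_eq hf γ hγ
  have h1 := plusSymbol_eq_ratPlusSymbol_mul_plusPeriod hf x
  rw [h1] at hm
  have hΩC : ((plusPeriod f : ℝ) : ℂ) ≠ 0 := by exact_mod_cast hΩ.ne'
  have hq : ((ratPlusSymbol f x : ℚ) : ℂ) = ((m / 2 : ℚ) : ℂ) := by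
    have := mul_right_cancel₀ hΩC hm
    rw [this]; push_cast; ring
  have hq' : ratPlusSymbol f x = (m : ℚ) / 2 := by exact_mod_cast hq
  rw [hq']
  push_cast
  rw [norm_div]
  have h2 : ‖(2 : ℚ_[p])‖ = 1 := by
    have hnd : ¬ (p : ℤ) ∣ 2 := by
      intro h
      have h' : p ∣ 2 := by exact_mod_cast h
      exact hp2 ((Nat.prime_dvd_prime_iff_eq hp Nat.prime_two).mp h')
    have hlt : ¬ ‖((2 : ℤ) : ℚ_[p])‖ < 1 := fun h => hnd (Padic.norm_intCast_lt_one_iff.mp h)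
    have hle : ‖((2 : ℤ) : ℚ_[p])‖ ≤ 1 := Padic.norm_int_le_one 2
    push_cast at hlt hle
    exact le_antisymm hle (not_lt.mp hlt)
  rw [h2, div_one]
  simpa using Padic.norm_int_le_one (p := p) m

end Cusp

/-! ### §2 THE CORE, cycle version -/

section Core

variable {p : ℕ} [Fact p.Prime]

/-- ★ **The core of the exceptional-zero road, cycle version.** As `…ExcCore.one_le_padicValRat_ratPlusSymbol_zero_of_symbolCongruence`,
but the `f`-side unit is taken ON A CYCLE `{∞, γ₁∞}` (`γ₁ ∈ Γ₀(N)`, `γ₁∞ ≠ ∞`) and NO integrality of `[x]⁺_f` is assumed: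
`κ = Ω_f/Ω⁺_f = [γ₁∞]⁺_f / (plusSymbol f (γ₁∞)/Ω_f)` is integral because `[γ₁∞]⁺_f ∈ ½ℤ` (`p` odd). Then, as there,
`plusSymbol g' 0/Ω_g = (Ω/Ω_g)(1 − c)Φ(0)/Ω ∈ 𝔪`, `plusSymbol f 0/Ω_f ∈ 𝔪`, `[0]⁺_f = κ·plusSymbol f 0/Ω_f ∈ 𝔪`: `[0]⁺_f = 0` or
`1 ≤ ord_p [0]⁺_f`. [cite: Vatsal1999, §1 (1.6) display (11), Remark (1.12)] [cite: GreenbergVatsal2000, §3 (18)–(19), Remark (3.4) and Lemma (3.6)]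
[cite: MazurTateTeitelbaum1986Invent, §I.8] -/
theorem one_le_padicValRat_ratPlusSymbol_zero_of_symbolCongruence_cycle
    (W : WeierstrassCurve ℚ) [W.IsElliptic] [W.IsGloballyMinimal] {N : ℕ} [NeZero N]
    {f g' : CuspForm (Gamma0 N) 2} (hf : IsNewformOf W f) (ι : PadicAlgCl p ≃+* ℂ) (hp2 : p ≠ 2)
    {Ωf Ωg : ℂ} (hΩf : Ωf ≠ 0) (hΩg : Ωg ≠ 0)
    (hψint : ∀ x : ℚ, Valued.v (ι.symm (plusSymbol g' x / Ωg)) ≤ 1)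
    (hcongr : ∀ x : ℚ, Valued.v (ι.symm (plusSymbol f x / Ωf - plusSymbol g' x / Ωg)) < 1)
    (hΨcyc : ∃ γ₁ : Gamma0 N, (γ₁ : SL(2, ℤ)) 1 0 ≠ 0 ∧
      Valued.v (ι.symm (plusSymbol f ((((γ₁ : SL(2, ℤ)) 0 0 : ℤ) : ℚ) / (((γ₁ : SL(2, ℤ)) 1 0 : ℤ) : ℚ)) / Ωf)) = 1)
    (q : ℕ) (Φ : ℚ → ℂ) (c : ℂ)
    (hshape : ∀ x : ℚ, plusSymbol g' x = Φ x - c * Φ (q * x))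
    (hc : Valued.v (ι.symm (c - 1)) < 1)
    {Ω : ℂ} (hΩint : ∀ x : ℚ, Valued.v (ι.symm (Φ x / Ω)) ≤ 1)
    (hΩunit : ∃ x₀ : ℚ, Valued.v (ι.symm ((Φ x₀ - c * Φ (q * x₀)) / Ω)) = 1) :
    ratPlusSymbol f 0 ≠ 0 → 1 ≤ padicValRat p (ratPlusSymbol f 0) := by
  intro h0
  -- Step 1 (`f`-side): `[x]⁺ = κ·Ψ(x)`, `κ = Ω_f/Ω⁺` integral by evaluation at the cycle `γ₁∞`
  have hΩpos : 0 < plusPeriod f := IsNewform0.plusPeriod_pos_holds hf.1 hf.coeffField_eq_bot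
  set κ : ℂ := Ωf / ((plusPeriod f : ℝ) : ℂ) with hκdef
  have hκ : ∀ x : ℚ, ((ratPlusSymbol f x : ℚ) : ℂ) = κ * (plusSymbol f x / Ωf) := by
    intro x
    rw [plusSymbol_eq_ratPlusSymbol_mul_plusPeriod hf x, hκdef]
    have : ((plusPeriod f : ℝ) : ℂ) ≠ 0 := by exact_mod_cast hΩpos.ne'
    field_simp
  have hκint : ‖ι.symm κ‖ ≤ 1 := by
    obtain ⟨γ₁, hγ₁, hx₁⟩ := hΨcyc
    set x₁ : ℚ := (((γ₁ : SL(2, ℤ)) 0 0 : ℤ) : ℚ) / (((γ₁ : SL(2, ℤ)) 1 0 : ℤ) : ℚ) with hx₁def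
    have h := congrArg ι.symm (hκ x₁)
    rw [map_mul] at h
    have h' : ‖ι.symm (((ratPlusSymbol f x₁ : ℚ) : ℂ))‖ = ‖ι.symm κ‖ := by
      rw [h, norm_mul, valuation_eq_one_iff.mp hx₁, mul_one]
    rw [← h', norm_symm_ratCast]
    exact norm_ratPlusSymbol_cusp_le_one hf hp2 γ₁ hγ₁
  -- Step 2 (`g`-side): `ψ(x) = λ · (Φ(x) − cΦ(qx))/Ω` with `λ = Ω/Ω_g`, `‖λ‖ ≤ 1`
  have hΩ0 : Ω ≠ 0 := by
    rintro rfl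
    obtain ⟨x₀, hx₀⟩ := hΩunit
    exact zero_ne_one (by rwa [div_zero, map_zero, Valuation.map_zero] at hx₀)
  set lam : ℂ := Ω / Ωg with hlamdef
  have hlam : ∀ x : ℚ, plusSymbol g' x / Ωg = lam * ((Φ x - c * Φ (q * x)) / Ω) := by
    intro x
    rw [hshape x, hlamdef]
    field_simp
  have hlamint : ‖ι.symm lam‖ ≤ 1 := by
    obtain ⟨x₀, hx₀⟩ := hΩunit
    have h := congrArg ι.symm (hlam x₀)
    rw [map_mul] at h
    have h' : ‖ι.symm (plusSymbol g' x₀ / Ωg)‖ = ‖ι.symm lam‖ := by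
      rw [h, norm_mul, valuation_eq_one_iff.mp hx₀, mul_one]
    rw [← h']
    exact valuation_le_one_iff.mp (hψint x₀)
  -- Step 3: `ψ(0) = λ (1 − c) Φ(0)/Ω` has norm `< 1`
  have hψ0 : ‖ι.symm (plusSymbol g' 0 / Ωg)‖ < 1 := by
    have h : plusSymbol g' 0 / Ωg = lam * ((1 - c) * (Φ 0 / Ω)) := by
      rw [hlam 0, mul_zero]
      ring
    rw [h, map_mul, map_mul, norm_mul, norm_mul]
    have h1c : ‖ι.symm (1 - c)‖ < 1 := by
      rw [← neg_sub, map_neg, norm_neg]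
      exact valuation_lt_one_iff.mp hc
    calc ‖ι.symm lam‖ * (‖ι.symm (1 - c)‖ * ‖ι.symm (Φ 0 / Ω)‖)
        ≤ 1 * (‖ι.symm (1 - c)‖ * 1) := by
          refine mul_le_mul hlamint ?_ (by positivity) zero_le_one
          exact mul_le_mul_of_nonneg_left (valuation_le_one_iff.mp (hΩint 0)) (norm_nonneg _)
      _ < 1 := by rw [one_mul, mul_one]; exact h1c
  -- Step 4: `Ψ_f(0) ≡ ψ(0)`, so `‖Ψ_f(0)‖ < 1`, so `‖[0]⁺_f‖ < 1`
  have hΨ0 : ‖ι.symm (plusSymbol f 0 / Ωf)‖ < 1 := by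
    have h1 := valuation_lt_one_iff.mp (hcongr 0)
    rw [map_sub] at h1
    have : ι.symm (plusSymbol f 0 / Ωf) =
        (ι.symm (plusSymbol f 0 / Ωf) - ι.symm (plusSymbol g' 0 / Ωg)) + ι.symm (plusSymbol g' 0 / Ωg) := by ring
    rw [this]
    exact lt_of_le_of_lt (PadicAlgCl.isNonarchimedean p _ _) (max_lt h1 hψ0)
  have hrat : ‖((ratPlusSymbol f 0 : ℚ) : ℚ_[p])‖ < 1 := by
    rw [← norm_symm_ratCast ι, hκ 0, map_mul, norm_mul]
    calc ‖ι.symm κ‖ * ‖ι.symm (plusSymbol f 0 / Ωf)‖ ≤ 1 * ‖ι.symm (plusSymbol f 0 / Ωf)‖ :=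
          mul_le_mul_of_nonneg_right hκint (norm_nonneg _)
      _ < 1 := by rw [one_mul]; exact hΨ0
  exact one_le_padicValRat_of_norm_lt_one h0 hrat

end Core

/-! ### §3 The Greenberg–Vatsal wrapper, cycle version (the path-unit of the fact moved to a cycle) -/

section GV

variable {p : ℕ} [Fact p.Prime]

/-- ★ **`[0]⁺_f ≡ 0` at a MULTIPLICATIVE `p ∥ N` from Greenberg–Vatsal 2000 BY NAME — no integrality binder.** Data: the
named fact `greenbergVatsal2000_plusSymbol_congruence` (hypothesis `hGV`); `W` with multiplicative reduction at the odd prime `p`,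
`E[p]` irreducible, `p² ∤ N`, `5 ≤ N`; its newform `f` at level `N`; ONE prime `r₀ ≡ 1 (mod N)`, `r₀ ∤ N`, with
`a_{r₀}(f) − r₀ − 1` a unit (Chebotarev, from `E[p]` irreducible); a normalised Hecke eigenform `g' ∈ S₂(Γ₀(N))` with number-field
`p`-integral coefficients, Vatsal's Condition 1, `aₙ(f) ≡ aₙ(g')` for ALL `n`; the old shape `(Φ, c)` of `plusSymbol g'` with
`c ≡ 1`; and the non-degeneracy `Ω` PRODUCED from `plusSymbol g' ≢ 0`. The fact (applied to `f₀ = f = ` its own family member at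
`M = N`, `U_p`-eigenvalue `a_p(E) = ±1` a unit, and `g'`) gives `Ω_f, Ω_g` and the path-unit `x₁`; `…ExcPeriodCycle` moves it to a
cycle (`T_{r₀} f = a_{r₀}(f) f`, `f` has real — indeed integer — coefficients); `plusSymbol g' x₁ ≠ 0` feeds the producer; §2 concludes.
[cite: GreenbergVatsal2000, §3 (17)–(19), proof of Thm. (3.10)] [cite: Vatsal1999, §1 (1.6), Remark (1.12), Thm. (1.13)] -/
theorem one_le_padicValRat_ratPlusSymbol_zero_of_greenbergVatsal_cycle (hGV : greenbergVatsal2000_plusSymbol_congruence)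
    (W : WeierstrassCurve ℚ) [W.IsElliptic] [W.IsGloballyMinimal] {N : ℕ} [NeZero N]
    {f g' : CuspForm (Gamma0 N) 2} (hf : IsNewformOf W f) (ι : PadicAlgCl p ≃+* ℂ) (hp2 : p ≠ 2)
    (hpN : ¬ p ^ 2 ∣ N) (h5 : 5 ≤ N) (hmult : W.HasMultiplicativeReductionAtPrime p)
    (hirr : W.HasIrreducibleModPGaloisRep p)
    {r₀ : ℕ} (hr₀ : r₀.Prime) (hr₀N : ¬ r₀ ∣ N) (hr₀1 : r₀ ≡ 1 [MOD N])
    (hE₀ : Valued.v (ι.symm (cuspCoeff f r₀ - (r₀ + 1))) = 1)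
    (hg : IsHeckeEigenform g') (hg1 : IsNormalized g') (hgK : FiniteDimensional ℚ (coeffField g'))
    (hgint : ∀ n : ℕ, Valued.v (ι.symm (cuspCoeff g' n)) ≤ 1) (hgC : HasSimpleHeckeGenEigenspace g')
    (hcong : ∀ n : ℕ, Valued.v (ι.symm (cuspCoeff f n - cuspCoeff g' n)) < 1)
    (q : ℕ) (Φ : ℚ → ℂ) (c : ℂ)
    (hshape : ∀ x : ℚ, plusSymbol g' x = Φ x - c * Φ (q * x))
    (hc : Valued.v (ι.symm (c - 1)) < 1)
    (hΩ : (∃ x : ℚ, plusSymbol g' x ≠ 0) →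
      ∃ Ω : ℂ, (∀ x : ℚ, Valued.v (ι.symm (Φ x / Ω)) ≤ 1) ∧
        ∃ x₀ : ℚ, Valued.v (ι.symm ((Φ x₀ - c * Φ (q * x₀)) / Ω)) = 1) :
    ratPlusSymbol f 0 ≠ 0 → 1 ≤ padicValRat p (ratPlusSymbol f 0) := by
  have hfC : HasSimpleHeckeGenEigenspace f :=
    KimAtThreeDeepLowerOffStratumLevelLoweringConditionOne.hasSimpleHeckeGenEigenspace_of_isNewform0 hf.1
  obtain ⟨Ωf, Ωg, hΩf, hΩg, hΨint, hψint, hcongr, x₁, hx₁⟩ :=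
    hGV p N N ι W f f g' hp2 h5 dvd_rfl hpN (Or.inr hmult) hirr hf hf.1.2.1 hf.1.2.2
      (finiteDimensional_coeffField_of_isNewformOf W hf) (valuation_cuspCoeff_le_one_of_isNewformOf hf ι) hfC
      (fun n _ => hf.2 n) (fun _ => valuation_cuspCoeff_eq_one_of_mult ι W hf hmult) hg hg1 hgK hgint hgC hcong
  -- the `f`-unit moved from the path `x₁` to a cycle `γ₁∞`
  have hreal : ∀ n, (cuspCoeff f n).im = 0 := fun n => by rw [hf.2 n]; simp
  haveI : NeZero r₀ := ⟨hr₀.ne_zero⟩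
  have hT : heckeT (Gamma0 N) 2 r₀ f = cuspCoeff f r₀ • f := hf.1.heckeT_eq_coeff_smul hr₀
  obtain ⟨γ₁, hγ₁, hγ₁u⟩ := exists_unit_cycle_of_unit_path_of_one_mod ι hreal hΨint ⟨x₁, hx₁⟩ hr₀ hr₀N hr₀1
    (valuation_cuspCoeff_le_one_of_isNewformOf hf ι r₀) hT hE₀
  obtain ⟨Ω, hΩint, hΩunit⟩ := hΩ ⟨x₁, plusSymbol_ne_zero_of_congr ι hcongr hx₁⟩
  exact one_le_padicValRat_ratPlusSymbol_zero_of_symbolCongruence_cycle W hf ι hp2 hΩf hΩg hψint hcongr ⟨γ₁, hγ₁, hγ₁u⟩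
    q Φ c hshape hc hΩint hΩunit

end GV

end Summit.BirchSwinnertonDyer.BirchSwinnertonDyer.Theorems.GL1Cartan.Exc

end
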